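import Literature.NumberTheory.Sieve.SmoothSaddlePointUniform
import HarnessLib

/-!
# A Dickman-type lower bound: `Ψ(x, y) ≥ δ(u) x` for `y ≥ x^{1/u}`

Topic `Literature/NumberTheory/Sieve`; a PROVED tool file (no definition, no named fact) toward
`Literature.NumberTheory.Sieve.HTLocalBehaviour` (Hildebrand–Tenenbaum 1986, Theorem 3). In the range
of bounded `u = log x/log y` the deduction of Theorem 3 from Theorem 1 needs only that `Ψ(x, y)` has
order `x` there (op. cit. §6, p. 283: "In the case `y > y₀`, `1 ≤ u ≤ u₀`, … (6.1) can be deduced from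
(1.5) [de Bruijn's `Ψ(x, y) = x ρ(u)(1 + O(log(u+1)/log y))`] and the estimate `α(x, y) = 1 + O(1/log y)`").
Instead of de Bruijn's asymptotic we prove the positive-density lower bound of Dickman type that
suffices, by the classical half-integer induction on `u` with Chebyshev's bounds only:

* `exists_card_smoothNumbersUpTo_ge_mul` — for every `n : ℕ` there are `δ > 0`, `X₀` with
  `Ψ(x, y) ≥ δ x` for `x ≥ X₀`, `y ≥ x^{1/u}`, `u = 1 + n/2`;
* `exists_card_smoothNumbersUpTo_ge_mul_of_le_rpow` — the same for any real `u₀ ≥ 1`: `Ψ(x, y) ≥ δ x`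
  for `x ≥ X₀` and `x ≤ y^{u₀}`.

Here `Ψ(x, y) = #(Nat.smoothNumbersUpTo ⌊x⌋₊ (y + 1))` counts `1 ≤ m ≤ x` with all prime factors `≤ y`.

## The induction step `u → u + 1/2`

Put `z = x^{1/(u + 1/2)}`, `ε = 1/(2(u+1))`. For a prime `p ∈ (z^{1-ε}, z]` and a `p`-smooth `m ≤ x/p`
the products `m p` are distinct `z`-smooth integers `≤ x` (the prime `p` is recovered as the largest
prime factor), so `Ψ(x, y) ≥ Σ_{z^{1-ε} < p ≤ z} Ψ(x/p, p)`; since `p^{u+1} > z^{(1-ε)(u+1)} = x` each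
`Ψ(x/p, p)` is `≥ δ_u x/p` by the induction hypothesis, and `Σ_{z^{1-ε} < p ≤ z} 1/p ≥ ε/40`
(`exists_blocks`). (Dickman 1930: `Ψ(x, x^{1/u}) ∼ ρ(u) x`; only `≫_u x` is proved here.)

## References

* [HildebrandTenenbaum1986] A. Hildebrand, G. Tenenbaum, Trans. AMS 296 (1986) 265–290, §1 (1.1),
  §6 p. 283 (held: `paper:doi-10-1090-s0002-9947-1986-0837811-1`).
* K. Dickman, *On the frequency of numbers containing prime factors of a certain relative magnitude*,
  Ark. Mat. Astr. Fys. 22 (1930) 1–14 (not held; only the elementary lower bound is proved here).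
-/

noncomputable section

open Real Finset Chebyshev

namespace Literature.NumberTheory.Sieve

/-- All `1 ≤ m ≤ x` are `y`-smooth when `x ≤ y`: `Ψ(x, y) ≥ ⌊x⌋ ≥ x - 1`. [folklore] -/
theorem sub_one_le_card_smoothNumbersUpTo_of_le {x : ℝ} {y : ℕ} (hx : 0 ≤ x) (hxy : x ≤ y) :
    x - 1 ≤ #(Nat.smoothNumbersUpTo ⌊x⌋₊ (y + 1)) := by
  have hsub : Finset.Icc 1 ⌊x⌋₊ ⊆ Nat.smoothNumbersUpTo ⌊x⌋₊ (y + 1) := by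
    intro m hm
    rw [Finset.mem_Icc] at hm
    rw [Nat.mem_smoothNumbersUpTo, Nat.mem_smoothNumbers]
    refine ⟨hm.2, Nat.one_le_iff_ne_zero.1 hm.1, fun p hp => ?_⟩
    have hpm : p ≤ m := Nat.le_of_mem_primeFactorsList hp
    have hmy : m ≤ y := by
      have : (m : ℝ) ≤ y := le_trans (le_trans (by exact_mod_cast hm.2) (Nat.floor_le hx)) hxy
      exact_mod_cast this
    omega
  have h1 := Finset.card_le_card hsub
  rw [Nat.card_Icc, Nat.add_sub_cancel] at h1
  have h2 : (⌊x⌋₊ : ℝ) ≤ #(Nat.smoothNumbersUpTo ⌊x⌋₊ (y + 1)) := by exact_mod_cast h1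
  linarith [Nat.lt_floor_add_one x]

/-- **The injection `(p, m) ↦ m p`.** For a real `z ≤ y`, a finset `P` of primes `≤ z` and `x ≥ 0`:
`Σ_{p ∈ P} Ψ(x/p, p) ≤ Ψ(x, y)` (the products `m p`, `m ≤ x/p` `p`-smooth, are distinct `y`-smooth
integers `≤ x`: from `m p = m' p'` with `p < p'` the prime `p'` would divide the `p`-smooth `m`).
[folklore] -/
theorem sum_card_smoothNumbersUpTo_div_le {x z : ℝ} {y : ℕ} (hx : 0 ≤ x) (hzy : z ≤ y)
    (P : Finset ℕ) (hP : ∀ p ∈ P, p.Prime ∧ (p : ℝ) ≤ z) :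
    ∑ p ∈ P, (#(Nat.smoothNumbersUpTo ⌊x / p⌋₊ (p + 1)) : ℝ) ≤
      #(Nat.smoothNumbersUpTo ⌊x⌋₊ (y + 1)) := by
  classical
  set t : ℕ → Finset ℕ := fun p => (Nat.smoothNumbersUpTo ⌊x / p⌋₊ (p + 1)).image (fun m => m * p)
    with ht
  -- pairwise disjoint
  have hdisj : (P : Set ℕ).PairwiseDisjoint t := by
    intro p hp q hq hpq
    rw [Function.onFun, Finset.disjoint_left]
    intro a ha hb
    simp only [ht, Finset.mem_image, Nat.mem_smoothNumbersUpTo] at ha hb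
    obtain ⟨m, ⟨-, hm⟩, rfl⟩ := ha
    obtain ⟨m', ⟨-, hm'⟩, heq⟩ := hb
    have hpp := (hP p hp).1
    have hqp := (hP q hq).1
    -- `q ∣ m p` forces `q ≤ p`, and symmetrically `p ≤ q`
    have hq_le : q ≤ p := by
      have hd : q ∣ m * p := ⟨m', by rw [← heq]; ring⟩
      rcases (Nat.Prime.dvd_mul hqp).1 hd with h | h
      · have := (Nat.mem_smoothNumbers.1 hm).2 q ((Nat.mem_primeFactorsList hm.1).2 ⟨hqp, h⟩)
        omega
      · exact le_of_eq ((Nat.prime_dvd_prime_iff_eq hqp hpp).1 h)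
    have hp_le : p ≤ q := by
      have hd : p ∣ m' * q := ⟨m, by rw [heq]; ring⟩
      rcases (Nat.Prime.dvd_mul hpp).1 hd with h | h
      · have := (Nat.mem_smoothNumbers.1 hm').2 p ((Nat.mem_primeFactorsList hm'.1).2 ⟨hpp, h⟩)
        omega
      · exact le_of_eq ((Nat.prime_dvd_prime_iff_eq hpp hqp).1 h)
    exact hpq (le_antisymm hp_le hq_le)
  -- contained in the `y`-smooth numbers `≤ x`
  have hsub : P.biUnion t ⊆ Nat.smoothNumbersUpTo ⌊x⌋₊ (y + 1) := by
    intro a ha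
    rw [Finset.mem_biUnion] at ha
    obtain ⟨p, hp, ha⟩ := ha
    simp only [ht, Finset.mem_image, Nat.mem_smoothNumbersUpTo] at ha
    obtain ⟨m, ⟨hmx, hm⟩, rfl⟩ := ha
    obtain ⟨hpp, hpz⟩ := hP p hp
    have hp0 : (0 : ℝ) < p := by exact_mod_cast hpp.pos
    have hpy : p ≤ y := by
      have : (p : ℝ) ≤ y := hpz.trans hzy
      exact_mod_cast this
    rw [Nat.mem_smoothNumbersUpTo]
    constructor
    · -- `m p ≤ x`
      refine Nat.le_floor ?_
      have h1 : (m : ℝ) ≤ x / p := le_trans (by exact_mod_cast hmx) (Nat.floor_le (by positivity))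
      rw [le_div_iff₀ hp0] at h1
      push_cast
      exact h1
    · -- `m p` is `(y+1)`-smooth
      have h1 : m * p ∈ Nat.smoothNumbers (p + 1) :=
        Nat.mul_mem_smoothNumbers hm (Nat.mem_smoothNumbers_of_lt hpp.pos (Nat.lt_succ_self p))
      exact Nat.smoothNumbers_mono (by omega) h1
  have hcard : #(P.biUnion t) = ∑ p ∈ P, #(Nat.smoothNumbersUpTo ⌊x / p⌋₊ (p + 1)) := by
    rw [Finset.card_biUnion hdisj]
    refine Finset.sum_congr rfl fun p hp => ?_
    rw [ht]
    exact Finset.card_image_of_injective _ (mul_left_injective₀ (hP p hp).1.ne_zero)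
  calc ∑ p ∈ P, (#(Nat.smoothNumbersUpTo ⌊x / p⌋₊ (p + 1)) : ℝ) = #(P.biUnion t) := by
        rw [hcard]; push_cast; rfl
    _ ≤ #(Nat.smoothNumbersUpTo ⌊x⌋₊ (y + 1)) := by exact_mod_cast Finset.card_le_card hsub

/-- **Dickman-type positive density (half-integer induction).** For every `n : ℕ` there are `δ > 0`
and `X₀` with `Ψ(x, y) ≥ δ x` for all real `x ≥ X₀` and all `y ≥ x^{1/u}`, `u = 1 + n/2`. Step
`u → u + 1/2` as in the module docstring: `Ψ(x, y) ≥ Σ_{z^{1-ε} < p ≤ z} Ψ(x/p, p) ≥ δ_u x Σ 1/p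
≥ δ_u (ε/40) x` with `z = x^{1/(u+1/2)}`, `ε = 1/(2(u+1))`. (Dickman 1930 / de Bruijn: `Ψ(x, x^{1/u})
∼ ρ(u) x`; only the lower bound `≫_u x` is proved.) [folklore] -/
theorem exists_card_smoothNumbersUpTo_ge_mul (n : ℕ) :
    ∃ δ : ℝ, 0 < δ ∧ ∃ X₀ : ℝ, ∀ (x : ℝ) (y : ℕ), X₀ ≤ x →
      x ^ (1 / (1 + (n : ℝ) / 2)) ≤ (y : ℝ) →
        δ * x ≤ #(Nat.smoothNumbersUpTo ⌊x⌋₊ (y + 1)) := by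
  induction n with
  | zero =>
      refine ⟨1 / 2, by norm_num, 2, fun x y hx hxy => ?_⟩
      simp only [CharP.cast_eq_zero, zero_div, add_zero, div_one, Real.rpow_one] at hxy
      have := sub_one_le_card_smoothNumbersUpTo_of_le (by linarith) hxy
      linarith
  | succ n ih =>
      obtain ⟨δ, hδ, X₀, hX⟩ := ih
      obtain ⟨t₀, ht₀2, -, hinv, -⟩ := exists_blocks
      set u : ℝ := 1 + (n : ℝ) / 2 with hu
      have hn0 : (0 : ℝ) ≤ n := Nat.cast_nonneg n
      have hu1 : 1 ≤ u := by rw [hu]; linarith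
      have hu' : (1 + ((n + 1 : ℕ) : ℝ) / 2) = u + 1 / 2 := by rw [hu]; push_cast; ring
      set v : ℝ := u + 1 / 2 with hv
      have hv32 : 3 / 2 ≤ v := by rw [hv]; linarith
      have hv0 : 0 < v := by linarith
      set ε : ℝ := 1 / (2 * (u + 1)) with hε
      have hε0 : 0 < ε := by rw [hε]; positivity
      have hε1 : ε ≤ 1 / 4 := by
        rw [hε, div_le_div_iff₀ (by positivity) (by norm_num)]; linarith
      have hkey : (1 - ε) * (u + 1) = v := by rw [hε, hv]; field_simp; ring
      -- thresholds
      set X₁ : ℝ := max X₀ 1 with hX₁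
      have hX₁1 : 1 ≤ X₁ := le_max_right _ _
      have hX₁0 : X₀ ≤ X₁ := le_max_left _ _
      set X : ℝ := max (max (X₁ ^ (3 : ℕ)) (Real.exp (4 * v / ε))) ((t₀ ^ (2 : ℕ)) ^ v) with hXdef
      refine ⟨δ * (ε / 40), by positivity, X, fun x y hx hxy => ?_⟩
      rw [hu'] at hxy
      have hxX₁ : X₁ ^ (3 : ℕ) ≤ x := le_trans ((le_max_left _ _).trans (le_max_left _ _)) hx
      have hxexp : Real.exp (4 * v / ε) ≤ x := le_trans ((le_max_right _ _).trans (le_max_left _ _)) hx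
      have hxt : (t₀ ^ (2 : ℕ)) ^ v ≤ x := le_trans (le_max_right _ _) hx
      have hx1 : 1 ≤ x := le_trans (one_le_pow₀ hX₁1) hxX₁
      have hx0 : 0 < x := by linarith
      -- `z = x^{1/v}`
      set z : ℝ := x ^ (1 / v) with hz
      have hz0 : 0 < z := Real.rpow_pos_of_pos hx0 _
      have hzv : z ^ v = x := by
        rw [hz, ← Real.rpow_mul hx0.le, one_div_mul_cancel hv0.ne', Real.rpow_one]
      have hlogz : Real.log z = Real.log x / v := by
        rw [hz, Real.log_rpow hx0]; ring
      have hzy : z ≤ y := hxy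
      -- `z ≥ t₀²`, so `z > 1` and `z^{1-ε} ≥ t₀`
      have hzt : t₀ ^ (2 : ℕ) ≤ z := by
        have h1 : ((t₀ ^ (2 : ℕ)) ^ v) ^ (1 / v) ≤ x ^ (1 / v) :=
          Real.rpow_le_rpow (by positivity) hxt (by positivity)
        rwa [← Real.rpow_mul (by positivity), mul_one_div_cancel hv0.ne', Real.rpow_one] at h1
      have ht₀1 : 1 ≤ t₀ := by linarith
      have hz1 : 1 < z := by nlinarith
      have hzε : t₀ ≤ z ^ (1 - ε) := by
        calc t₀ = t₀ ^ (1 : ℝ) := (Real.rpow_one _).symm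
          _ ≤ t₀ ^ (2 * (1 - ε)) := Real.rpow_le_rpow_of_exponent_le ht₀1 (by linarith)
          _ = (t₀ ^ (2 : ℕ)) ^ (1 - ε) := by
              rw [Real.rpow_mul (by linarith), Real.rpow_two]
          _ ≤ z ^ (1 - ε) := Real.rpow_le_rpow (by positivity) hzt (by linarith)
      -- `ε log z ≥ 4`
      have hεz : 4 ≤ ε * Real.log z := by
        have h1 : 4 * v / ε ≤ Real.log x := by
          have := Real.log_le_log (Real.exp_pos _) hxexp
          rwa [Real.log_exp] at this
        rw [hlogz]
        rw [div_le_iff₀ hε0] at h1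
        rw [mul_div_assoc', le_div_iff₀ hv0]
        linarith
      -- the primes `p ∈ (z^{1-ε}, z]`
      set P := (Nat.primesLE ⌊(z : ℝ)⌋₊).filter (fun p : ℕ => (z ^ (1 - ε) : ℝ) < (p : ℝ)) with hPdef
      have hPprime : ∀ p ∈ P, p.Prime ∧ (p : ℝ) ≤ z := by
        intro p hp
        rw [hPdef, Finset.mem_filter, Nat.mem_primesLE] at hp
        exact ⟨hp.1.2, le_trans (by exact_mod_cast hp.1.1) (Nat.floor_le hz0.le)⟩
      have hsum := sum_card_smoothNumbersUpTo_div_le hx0.le hzy P hPprime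
      have hblock := hinv ε z hz1 hε0 (by linarith) hεz hzε
      -- the induction hypothesis at `(x/p, p)` for `p ∈ P`
      have hIH : ∀ p ∈ P, δ * (x / p) ≤ #(Nat.smoothNumbersUpTo ⌊x / p⌋₊ (p + 1)) := by
        intro p hp
        have hp' := hp
        rw [hPdef, Finset.mem_filter, Nat.mem_primesLE] at hp'
        obtain ⟨⟨hpz, hpp⟩, hpε⟩ := hp'
        have hp2 : (2 : ℝ) ≤ p := by exact_mod_cast hpp.two_le
        have hp0 : (0 : ℝ) < p := by linarith
        have hpz' : (p : ℝ) ≤ z := le_trans (by exact_mod_cast hpz) (Nat.floor_le hz0.le)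
        refine hX (x / p) p ?_ ?_
        · -- `x/p ≥ x/z = x^{1 - 1/v} ≥ x^{1/3} ≥ X₁ ≥ X₀`
          have h1 : x / z ≤ x / p := div_le_div_of_nonneg_left hx0.le hp0 hpz'
          have h2 : x / z = x ^ (1 - 1 / v) := by
            rw [hz, Real.rpow_sub hx0, Real.rpow_one]
          have h3 : x ^ (1 / 3 : ℝ) ≤ x ^ (1 - 1 / v) := by
            refine Real.rpow_le_rpow_of_exponent_le hx1 ?_
            rw [le_sub_iff_add_le, div_add_div _ _ (by norm_num) hv0.ne', div_le_one (by positivity)]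
            linarith
          have h4 : X₁ ≤ x ^ (1 / 3 : ℝ) := by
            have := Real.rpow_le_rpow (by positivity) hxX₁ (by norm_num : (0 : ℝ) ≤ 1 / 3)
            rwa [← Real.rpow_natCast, ← Real.rpow_mul (by linarith), show ((3 : ℕ) : ℝ) * (1 / 3) = 1 by
              norm_num, Real.rpow_one] at this
          linarith
        · -- `(x/p)^{1/u} ≤ p` since `x ≤ p^{u+1}` (`p > z^{1-ε}`, `z^{(1-ε)(u+1)} = x`)
          have h1 : x ≤ (p : ℝ) ^ (u + 1) := by
            have h2 : (z ^ (1 - ε)) ^ (u + 1) ≤ (p : ℝ) ^ (u + 1) :=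
              Real.rpow_le_rpow (by positivity) hpε.le (by linarith)
            rwa [← Real.rpow_mul hz0.le, hkey, hzv] at h2
          have h2 : x / p ≤ (p : ℝ) ^ u := by
            rw [div_le_iff₀ hp0]
            calc x ≤ (p : ℝ) ^ (u + 1) := h1
              _ = (p : ℝ) ^ u * p := by rw [Real.rpow_add hp0, Real.rpow_one]
          calc (x / p) ^ (1 / u) ≤ ((p : ℝ) ^ u) ^ (1 / u) :=
                Real.rpow_le_rpow (by positivity) h2 (by positivity)
            _ = p := by rw [← Real.rpow_mul hp0.le, mul_one_div_cancel (by linarith), Real.rpow_one]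
      -- assemble
      calc δ * (ε / 40) * x = δ * x * (ε / 40) := by ring
        _ ≤ δ * x * ∑ p ∈ P, (1 : ℝ) / p := mul_le_mul_of_nonneg_left hblock (by positivity)
        _ = ∑ p ∈ P, δ * (x / p) := by rw [Finset.mul_sum]; refine Finset.sum_congr rfl fun p _ => ?_; ring
        _ ≤ ∑ p ∈ P, (#(Nat.smoothNumbersUpTo ⌊x / p⌋₊ (p + 1)) : ℝ) := Finset.sum_le_sum hIH
        _ ≤ #(Nat.smoothNumbersUpTo ⌊x⌋₊ (y + 1)) := hsum

/-- **`Ψ(x, y) ≥ δ x` for `x ≤ y^{u₀}`** (`u₀ ≥ 1` real; `δ = δ(u₀) > 0`, `x ≥ X₀(u₀)`): the case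
`u = 1 + ⌈2(u₀ - 1)⌉/2 ≥ u₀` of `exists_card_smoothNumbersUpTo_ge_mul`. This is the positive-density
input replacing de Bruijn's (1.5) in the small-`u` case of [HildebrandTenenbaum1986, §6]. [folklore] -/
theorem exists_card_smoothNumbersUpTo_ge_mul_of_le_rpow {u₀ : ℝ} (hu₀ : 1 ≤ u₀) :
    ∃ δ : ℝ, 0 < δ ∧ ∃ X₀ : ℝ, ∀ (x : ℝ) (y : ℕ), X₀ ≤ x → 2 ≤ y → x ≤ (y : ℝ) ^ u₀ →
      δ * x ≤ #(Nat.smoothNumbersUpTo ⌊x⌋₊ (y + 1)) := by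
  set n : ℕ := ⌈2 * (u₀ - 1)⌉₊ with hn
  obtain ⟨δ, hδ, X₀, hX⟩ := exists_card_smoothNumbersUpTo_ge_mul n
  refine ⟨δ, hδ, max X₀ 1, fun x y hx hy hxy => hX x y (le_trans (le_max_left _ _) hx) ?_⟩
  have hx1 : 1 ≤ x := le_trans (le_max_right _ _) hx
  have hy1 : (1 : ℝ) < y := by exact_mod_cast lt_of_lt_of_le one_lt_two hy
  have hu : u₀ ≤ 1 + (n : ℝ) / 2 := by
    have := Nat.le_ceil (2 * (u₀ - 1))
    rw [← hn] at this
    linarith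
  have hu0 : 0 < u₀ := by linarith
  -- `x^{1/(1 + n/2)} ≤ x^{1/u₀} ≤ y`
  calc x ^ (1 / (1 + (n : ℝ) / 2)) ≤ x ^ (1 / u₀) :=
        Real.rpow_le_rpow_of_exponent_le hx1 (one_div_le_one_div_of_le hu0 hu)
    _ ≤ ((y : ℝ) ^ u₀) ^ (1 / u₀) := Real.rpow_le_rpow (by linarith) hxy (by positivity)
    _ = y := by rw [← Real.rpow_mul (by linarith), mul_one_div_cancel hu0.ne', Real.rpow_one]

end Literature.NumberTheory.Sieve
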